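import Mathlib

/-!
# The "trivial for every square of a grid ⇒ small connected components" step of the barrier-function
# genericity device: a kernel-checked counter-model (diagonal segment in general position)

CITATION HEADER (lean-in-tree rule 2026-08-18). Source under adjudication: C.-Q. Cheng, J. Xue, *Arnold
diffusion for nearly integrable Hamiltonian systems*, Sci. China Math. **66** (2023) no. 8, 1649–1712,
doi:10.1007/s11425-022-2118-1 (bib key `ChengXue2023`), read in the last arXiv text arXiv:1503.04153v5
(`n-diffusion05082019.tex`, locators `l.NNNN`), Appendix E "Generic condition for invariant curves", proof of
Theorem `fundamental` (l.2895–2899) from Lemma `LmFundamental` (l.3086–3090), at l.3095–3096 (verbatim):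
"A connected set V is said to be non-trivial for 𝕊_{d₁}(q*) if π_iV∩𝕊_{d₁}(q*)=π_i𝕊_{d₁}(q*) holds for i=1
or 2. Otherwise, it is said to be trivial for 𝕊_{d₁}(q*). To finish the proof of Theorem [fundamental], we
split the annulus N_k equally into squares {𝕊_j=|q-q_j|≤d₁/5}. By Lemma [LmFundamental], for each 𝕊_j, there
exists an open-dense set 𝔒_{k,j} ⊂ 𝔅_ε, for each H_δ ∈ 𝔒_{k,j} it holds simultaneously for all c ∈ I_k∩Γ*_c
that the set Argmin(𝕊_j,B^ℓ_{c,ε}) is trivial for 𝕊_j. The intersection ∩𝔒_{k,j} is still open-dense in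
𝔅_ε. For each H_δ ∈ ∩_{k,j}𝔒_{k,j}, it holds simultaneously for all c ∈ Γ*_c that the diameter of each
connected component of the Mañé set is not larger than (4/5)d₁ if it keeps away from the Aubry set."
Here 𝕊_{d₁}(q*) = {|q − q*| ≤ d₁} ⊂ 𝕋² is an axis-parallel square (l.3082), Argmin(𝕊, B) = {q ∈ 𝕊 : B(q) =
min_𝕊 B} (l.3084), and what Lemma `LmFundamental` delivers is (Z1)–(Z2) of l.3110/l.3131:
π_i Argmin(𝕊_{d₁}(q*), B^ℓ_c + S_δ) ⊊ [q_i* − d₁, q_i* + d₁] for i = 1, 2 — a statement about subsets OF THE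
SQUARE.  The same step is printed in the published lineage the appendix follows (l.2857 "we apply the ideas
developed in [CY1, CY2]"; l.3163 "[LmFundamental] was proved in Section 4.2 of [C17b] as Theorem 4.2"):
C.-Q. Cheng, *Dynamics around the double resonance*, Camb. J. Math. **5** (2017) 153–228, p. 205 l.30–42
("Dividing the torus 𝖳 into squares with the side length d … If for each of the squares and for i = 1, 3, one
has Π_i argmin(u⁻_{σ,l} − u⁺_{σ,u})|_D ⊊ [x_{i,0} − d, x_{i,0} + d], the diameter of each connected component
of argmin(u⁻_{σ,l} − u⁺_{σ,u})|_𝖳 will not be larger than 2d") and p. 211 l.3–9; C.-Q. Cheng, J. Yan, J.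
Differential Geom. **82** (2009) 229–277, p. 273–274 ("we say a connected set V is non-trivial for R_d if
Π_i(V ∩ R_d) = {x_i* − d ≤ x_i ≤ x_i* + d} for some 0 ≤ i ≤ n … Given d_i > 0, there are finitely many u_ij
such that ∪_j R_{d_i}(u_ij) ⊇ U. Thus there exists a sequence d_i → 0 and a countable set {u_ij} such that for
each G₁ ∈ ∩ H(d_i, u_ij), F_σ + G₁ ⊂ Z_c").  THESE ARE CLAIMS UNDER ADJUDICATION by the pub-arnold near-miss
cell (LEMMAS §3.X AF6, item (E4); claim row C42; GAPS 2026-08-18 typer g11): nothing in this file asserts or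
uses any statement of those papers as a fact.

WHAT IS PROVED HERE (elementary real point-set facts only, nothing about Hamiltonian systems).  Reading (R1)
of "non-trivial" (`NontrivialFor`; the one of [CY2] p. 273 and [C17b] p. 205, and the only one under which the
output of Lemma `LmFundamental` — a statement about Argmin ⊆ 𝕊 — is what the proof of the theorem invokes):
* `trivial_of_subset_diagSeg`: every subset of the diagonal segment {(x, x − t) : 0 ≤ x ≤ L} is TRIVIAL for
  every closed axis-parallel square {|q − c|_∞ ≤ r}, r > 0, whose centre is off the line (t ≠ c₁ − c₂);
* `exists_offset_trivial_forall`: hence for ANY finite family of such squares (any centres, any radii — in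
  particular every "equal splitting" of l.3096 and every finite cover) there is an offset t for which every
  subset of the segment is trivial for every square of the family, for every length L;
* `squareCriterion_false`: consequently the abstract implication used at l.3096 — "for every square of the
  family, no connected V ⊆ M is non-trivial for it ⟹ every connected V ⊆ M has diameter ≤ D" — is FALSE for
  every finite family of squares and every bound D (witness M = a diagonal segment of length |D| + 1, compact and
  connected; `Metric.diam` is taken in the sup metric of ℝ × ℝ, which is Mathlib's product metric and the
  `|·|` of l.3082).
* `nontrivialFor_iff_of_subset`: for V ⊆ 𝕊 reading (R1) coincides with reading (R2) "π_i V ⊇ π_i 𝕊"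
  (`CoversSideOf`), so (Z1)–(Z2) cannot distinguish the readings, while under (R2) the long diagonal segment IS
  non-trivial for a square it crosses (`diagSeg_coversSide`) — i.e. (R2) would make the l.3096 sentence true but
  is not what the lemma supplies.
CONSEQUENCE recorded by the cell (typed, NOT adjudicated; owners C16/C17): the sentence l.3096 does not follow
from Lemma `LmFundamental` as stated; the cell's GAPS block sketches a repair (grid BOXES with unequal sides and a
boundary-bumping step) which is the cell's and is not citable.  All declarations are kernel-checked and tagged
[folklore].
-/

open Set

namespace Literature.Dynamics.Hamiltonian.ChengXue2023

/-- The closed axis-parallel square `{q : |q₁ - c₁| ≤ r ∧ |q₂ - c₂| ≤ r}` (v5 l.3082 `𝕊_{d₁}(q*) = {|q-q*| ≤ d₁}`).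
[folklore] -/
def sq (c : ℝ × ℝ) (r : ℝ) : Set (ℝ × ℝ) :=
  {q | |q.1 - c.1| ≤ r ∧ |q.2 - c.2| ≤ r}

/-- Reading (R1) of v5 l.3095 (= [CY2] p. 273, [C17b] p. 205): `V` is non-trivial for the square `S` iff the
projection of `V ∩ S` to the first or to the second coordinate is the whole corresponding side of `S`.
[folklore] -/
def NontrivialFor (V S : Set (ℝ × ℝ)) : Prop :=
  Prod.fst '' (V ∩ S) = Prod.fst '' S ∨ Prod.snd '' (V ∩ S) = Prod.snd '' S

/-- Reading (R2) of v5 l.3095: the projection of `V` itself covers a side of `S`. [folklore] -/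
def CoversSideOf (V S : Set (ℝ × ℝ)) : Prop :=
  Prod.fst '' S ⊆ Prod.fst '' V ∨ Prod.snd '' S ⊆ Prod.snd '' V

/-- The diagonal segment `{(x, x - t) : 0 ≤ x ≤ L}` (slope 1, vertical offset `-t`). [folklore] -/
def diagSeg (t L : ℝ) : Set (ℝ × ℝ) :=
  (fun x : ℝ => (x, x - t)) '' Icc 0 L

/-- Midpoint of the left edge. [folklore] -/
theorem left_mem_sq (c : ℝ × ℝ) {r : ℝ} (hr : 0 ≤ r) : (c.1 - r, c.2) ∈ sq c r := by
  refine ⟨?_, ?_⟩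
  · rw [show c.1 - r - c.1 = -r by ring, abs_neg, abs_of_nonneg hr]
  · simp [hr]

/-- Midpoint of the right edge. [folklore] -/
theorem right_mem_sq (c : ℝ × ℝ) {r : ℝ} (hr : 0 ≤ r) : (c.1 + r, c.2) ∈ sq c r := by
  refine ⟨?_, ?_⟩
  · rw [show c.1 + r - c.1 = r by ring, abs_of_nonneg hr]
  · simp [hr]

/-- Midpoint of the bottom edge. [folklore] -/
theorem bot_mem_sq (c : ℝ × ℝ) {r : ℝ} (hr : 0 ≤ r) : (c.1, c.2 - r) ∈ sq c r := by
  refine ⟨?_, ?_⟩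
  · simp [hr]
  · rw [show c.2 - r - c.2 = -r by ring, abs_neg, abs_of_nonneg hr]

/-- Midpoint of the top edge. [folklore] -/
theorem top_mem_sq (c : ℝ × ℝ) {r : ℝ} (hr : 0 ≤ r) : (c.1, c.2 + r) ∈ sq c r := by
  refine ⟨?_, ?_⟩
  · simp [hr]
  · rw [show c.2 + r - c.2 = r by ring, abs_of_nonneg hr]

/-- KEY LEMMA. Every subset of the diagonal segment is trivial (reading (R1)) for every square of positive
radius whose centre does not lie on the line `x₂ = x₁ - t`. [folklore] -/
theorem trivial_of_subset_diagSeg {V : Set (ℝ × ℝ)} {t L : ℝ} (hV : V ⊆ diagSeg t L) {c : ℝ × ℝ} {r : ℝ}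
    (hr : 0 < r) (ht : t ≠ c.1 - c.2) : ¬ NontrivialFor V (sq c r) := by
  rintro (h | h)
  · -- first projection full: the abscissae `c.1 - r` and `c.1 + r` are attained on `V ∩ S`
    have hlo : c.1 - r ∈ Prod.fst '' (V ∩ sq c r) := by
      rw [h]; exact ⟨(c.1 - r, c.2), left_mem_sq c hr.le, rfl⟩
    have hhi : c.1 + r ∈ Prod.fst '' (V ∩ sq c r) := by
      rw [h]; exact ⟨(c.1 + r, c.2), right_mem_sq c hr.le, rfl⟩
    obtain ⟨q, ⟨hqV, hqS⟩, hq⟩ := hlo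
    obtain ⟨x, -, rfl⟩ := hV hqV
    obtain ⟨q', ⟨hq'V, hq'S⟩, hq'⟩ := hhi
    obtain ⟨x', -, rfl⟩ := hV hq'V
    simp only at hq hq'
    obtain ⟨-, h2⟩ := hqS
    obtain ⟨-, h2'⟩ := hq'S
    simp only at h2 h2'
    rw [hq] at h2
    rw [hq'] at h2'
    obtain ⟨h2a, -⟩ := abs_le.mp h2
    obtain ⟨-, h2b'⟩ := abs_le.mp h2'
    exact ht (by linarith)
  · -- second projection full: the ordinates `c.2 - r` and `c.2 + r` are attained on `V ∩ S`
    have hlo : c.2 - r ∈ Prod.snd '' (V ∩ sq c r) := by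
      rw [h]; exact ⟨(c.1, c.2 - r), bot_mem_sq c hr.le, rfl⟩
    have hhi : c.2 + r ∈ Prod.snd '' (V ∩ sq c r) := by
      rw [h]; exact ⟨(c.1, c.2 + r), top_mem_sq c hr.le, rfl⟩
    obtain ⟨q, ⟨hqV, hqS⟩, hq⟩ := hlo
    obtain ⟨x, -, rfl⟩ := hV hqV
    obtain ⟨q', ⟨hq'V, hq'S⟩, hq'⟩ := hhi
    obtain ⟨x', -, rfl⟩ := hV hq'V
    simp only at hq hq'
    obtain ⟨h1, -⟩ := hqS
    obtain ⟨h1', -⟩ := hq'S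
    simp only at h1 h1'
    obtain ⟨h1a, -⟩ := abs_le.mp h1
    obtain ⟨-, h1b'⟩ := abs_le.mp h1'
    exact ht (by linarith)

/-- In particular the whole segment is trivial for such a square. [folklore] -/
theorem diagSeg_trivial {t L : ℝ} {c : ℝ × ℝ} {r : ℝ} (hr : 0 < r) (ht : t ≠ c.1 - c.2) :
    ¬ NontrivialFor (diagSeg t L) (sq c r) :=
  trivial_of_subset_diagSeg subset_rfl hr ht

/-- For ANY finite family of squares of positive radii there is an offset `t` such that every subset of the
diagonal segment of offset `t` (of any length) is trivial for every square of the family. [folklore] -/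
theorem exists_offset_trivial_forall {ι : Type*} [Finite ι] (c : ι → ℝ × ℝ) (r : ι → ℝ)
    (hr : ∀ i, 0 < r i) :
    ∃ t : ℝ, ∀ L : ℝ, ∀ i, ∀ V ⊆ diagSeg t L, ¬ NontrivialFor V (sq (c i) (r i)) := by
  have hinf : (Set.range fun i => (c i).1 - (c i).2)ᶜ.Infinite := (Set.finite_range _).infinite_compl
  obtain ⟨t, ht⟩ := hinf.nonempty
  refine ⟨t, fun L i V hV => trivial_of_subset_diagSeg hV (hr i) ?_⟩
  intro h
  exact ht ⟨i, h.symm⟩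

/-- The segment is connected. [folklore] -/
theorem diagSeg_isConnected (t : ℝ) {L : ℝ} (hL : 0 ≤ L) : IsConnected (diagSeg t L) :=
  (isConnected_Icc hL).image _ (by fun_prop : Continuous fun x : ℝ => (x, x - t)).continuousOn

/-- The segment is compact. [folklore] -/
theorem diagSeg_isCompact (t L : ℝ) : IsCompact (diagSeg t L) :=
  isCompact_Icc.image (by fun_prop : Continuous fun x : ℝ => (x, x - t))

/-- The two endpoints `(0, -t)` and `(L, L - t)` belong to the segment. [folklore] -/
theorem diagSeg_endpoints_mem (t : ℝ) {L : ℝ} (hL : 0 ≤ L) :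
    ((0 : ℝ), -t) ∈ diagSeg t L ∧ (L, L - t) ∈ diagSeg t L :=
  ⟨⟨0, ⟨le_rfl, hL⟩, by simp⟩, ⟨L, ⟨hL, le_rfl⟩, rfl⟩⟩

/-- Sup-metric distance of the endpoints is `L`. [folklore] -/
theorem dist_diagSeg_endpoints (t : ℝ) {L : ℝ} (hL : 0 ≤ L) :
    dist ((0 : ℝ), -t) (L, L - t) = L := by
  rw [Prod.dist_eq]
  dsimp only
  have h1 : dist (0 : ℝ) L = L := by rw [Real.dist_eq, zero_sub, abs_neg, abs_of_nonneg hL]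
  have h2 : dist (-t) (L - t) = L := by
    rw [Real.dist_eq, show (-t) - (L - t) = -L by ring, abs_neg, abs_of_nonneg hL]
  rw [h1, h2, max_self]

/-- The segment of length parameter `L ≥ 0` has diameter at least `L` (sup metric on `ℝ × ℝ`). [folklore] -/
theorem le_diam_diagSeg (t : ℝ) {L : ℝ} (hL : 0 ≤ L) : L ≤ Metric.diam (diagSeg t L) := by
  obtain ⟨h0, h1⟩ := diagSeg_endpoints_mem t hL
  have := Metric.dist_le_diam_of_mem (diagSeg_isCompact t L).isBounded h0 h1
  rwa [dist_diagSeg_endpoints t hL] at this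

/-- The implication invoked at v5 l.3096 ([C17b] p. 205, p. 211; [CY2] p. 274 with "totally disconnected"),
abstracted from barrier functions to an arbitrary compact set `M` (the set of minimal points) and a finite family
of squares (centres `c i`, radii `r i`): IF no connected subset of `M` is non-trivial (reading (R1)) for any
square of the family, THEN every connected subset of `M` has diameter at most `D`. [folklore] -/
def SquareCriterion {ι : Type*} (c : ι → ℝ × ℝ) (r : ι → ℝ) (D : ℝ) : Prop :=
  ∀ M : Set (ℝ × ℝ), IsCompact M →
    (∀ i, ∀ V ⊆ M, IsConnected V → ¬ NontrivialFor V (sq (c i) (r i))) →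
      ∀ V ⊆ M, IsConnected V → Metric.diam V ≤ D

/-- MAIN STATEMENT. For every finite family of squares with positive radii and every bound `D` the criterion is
false: a diagonal segment of length `|D| + 1` in general position is compact, connected, trivial for every square
of the family together with all its subsets, and has diameter `> D`. [folklore] -/
theorem squareCriterion_false {ι : Type*} [Finite ι] (c : ι → ℝ × ℝ) (r : ι → ℝ) (hr : ∀ i, 0 < r i)
    (D : ℝ) : ¬ SquareCriterion c r D := by
  intro hcrit
  obtain ⟨t, ht⟩ := exists_offset_trivial_forall c r hr
  set L : ℝ := |D| + 1 with hLdef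
  have hL : 0 ≤ L := by positivity
  have hdiam : Metric.diam (diagSeg t L) ≤ D :=
    hcrit (diagSeg t L) (diagSeg_isCompact t L) (fun i V hV _ => ht L i V hV) (diagSeg t L) subset_rfl
      (diagSeg_isConnected t hL)
  have hge : L ≤ Metric.diam (diagSeg t L) := le_diam_diagSeg t hL
  have : D < L := by rw [hLdef]; linarith [le_abs_self D]
  linarith

/-- For subsets of the square the two readings of l.3095 coincide; Lemma `LmFundamental` speaks only about
`Argmin(𝕊, B) ⊆ 𝕊`, so its output cannot distinguish them. [folklore] -/
theorem nontrivialFor_iff_of_subset {V S : Set (ℝ × ℝ)} (hVS : V ⊆ S) :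
    NontrivialFor V S ↔ CoversSideOf V S := by
  have hint : V ∩ S = V := inter_eq_left.mpr hVS
  unfold NontrivialFor CoversSideOf
  rw [hint]
  constructor
  · rintro (h | h)
    · exact Or.inl h.symm.subset
    · exact Or.inr h.symm.subset
  · rintro (h | h)
    · exact Or.inl (Subset.antisymm (image_mono hVS) h)
    · exact Or.inr (Subset.antisymm (image_mono hVS) h)

/-- Under reading (R2) a long diagonal segment IS non-trivial for a square whose first side it spans: so (R2)
would make the l.3096 sentence correct, but it is not what (Z1)–(Z2) provide. [folklore] -/
theorem diagSeg_coversSide {t L : ℝ} {c : ℝ × ℝ} {r : ℝ} (h0 : 0 ≤ c.1 - r)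
    (hL : c.1 + r ≤ L) : CoversSideOf (diagSeg t L) (sq c r) := by
  refine Or.inl ?_
  rintro x ⟨q, hq, rfl⟩
  obtain ⟨hq1, -⟩ := hq
  obtain ⟨hqa, hqb⟩ := abs_le.mp hq1
  exact ⟨(q.1, q.1 - t), ⟨q.1, ⟨by linarith, by linarith⟩, rfl⟩, rfl⟩

/-! ### The function-level model: Cheng–Xue's exact hypothesis (Z1)–(Z2) on EVERY square, conclusion false -/

/-- The centre belongs to the square. [folklore] -/
theorem centre_mem_sq (c : ℝ × ℝ) {r : ℝ} (hr : 0 ≤ r) : c ∈ sq c r := by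
  refine ⟨?_, ?_⟩ <;> simp [hr]

/-- Off the line through the centre, the abscissae of `diagSeg ∩ square` miss a whole open sub-interval of the
first side. [folklore] -/
theorem exists_Ioo_fst_missed {t : ℝ} (L : ℝ) {c : ℝ × ℝ} {r : ℝ} (hr : 0 < r) (ht : t ≠ c.1 - c.2) :
    ∃ a b : ℝ, a < b ∧ Ioo a b ⊆ Icc (c.1 - r) (c.1 + r) ∧
      ∀ x ∈ Prod.fst '' (diagSeg t L ∩ sq c r), x ∉ Ioo a b := by
  rcases lt_or_gt_of_ne ht with hlt | hgt
  · refine ⟨max (c.1 - r) (c.2 + t + r), c.1 + r, max_lt (by linarith) (by linarith), ?_, ?_⟩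
    · intro x hx
      exact ⟨((le_max_left _ _).trans_lt hx.1).le, hx.2.le⟩
    · rintro x ⟨q, ⟨hqV, hqS⟩, rfl⟩ hx
      obtain ⟨y, -, rfl⟩ := hqV
      obtain ⟨-, h2⟩ := hqS
      simp only at h2 hx
      obtain ⟨-, h2b⟩ := abs_le.mp h2
      have := (le_max_right (c.1 - r) (c.2 + t + r)).trans_lt hx.1
      linarith
  · refine ⟨c.1 - r, min (c.1 + r) (c.2 + t - r), lt_min (by linarith) (by linarith), ?_, ?_⟩
    · intro x hx
      exact ⟨hx.1.le, (hx.2.trans_le (min_le_left _ _)).le⟩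
    · rintro x ⟨q, ⟨hqV, hqS⟩, rfl⟩ hx
      obtain ⟨y, -, rfl⟩ := hqV
      obtain ⟨-, h2⟩ := hqS
      simp only at h2 hx
      obtain ⟨h2a, -⟩ := abs_le.mp h2
      have := hx.2.trans_le (min_le_right (c.1 + r) (c.2 + t - r))
      linarith

/-- Same for the ordinates and the second side. [folklore] -/
theorem exists_Ioo_snd_missed {t : ℝ} (L : ℝ) {c : ℝ × ℝ} {r : ℝ} (hr : 0 < r) (ht : t ≠ c.1 - c.2) :
    ∃ a b : ℝ, a < b ∧ Ioo a b ⊆ Icc (c.2 - r) (c.2 + r) ∧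
      ∀ z ∈ Prod.snd '' (diagSeg t L ∩ sq c r), z ∉ Ioo a b := by
  rcases lt_or_gt_of_ne ht with hlt | hgt
  · refine ⟨c.2 - r, min (c.2 + r) (c.1 - t - r), lt_min (by linarith) (by linarith), ?_, ?_⟩
    · intro z hz
      exact ⟨hz.1.le, (hz.2.trans_le (min_le_left _ _)).le⟩
    · rintro z ⟨q, ⟨hqV, hqS⟩, rfl⟩ hz
      obtain ⟨y, -, rfl⟩ := hqV
      obtain ⟨h1, -⟩ := hqS
      simp only at h1 hz
      obtain ⟨h1a, -⟩ := abs_le.mp h1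
      have := hz.2.trans_le (min_le_right (c.2 + r) (c.1 - t - r))
      linarith
  · refine ⟨max (c.2 - r) (c.1 - t + r), c.2 + r, max_lt (by linarith) (by linarith), ?_, ?_⟩
    · intro z hz
      exact ⟨((le_max_left _ _).trans_lt hz.1).le, hz.2.le⟩
    · rintro z ⟨q, ⟨hqV, hqS⟩, rfl⟩ hz
      obtain ⟨y, -, rfl⟩ := hqV
      obtain ⟨h1, -⟩ := hqS
      simp only at h1 hz
      obtain ⟨-, h1b⟩ := abs_le.mp h1
      have := (le_max_right (c.2 - r) (c.1 - t + r)).trans_lt hz.1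
      linarith

/-- A point of the first side missed by the abscissae of `diagSeg ∩ square` AND by a given finite set.
[folklore] -/
theorem exists_fst_missed {t : ℝ} (L : ℝ) {c : ℝ × ℝ} {r : ℝ} (hr : 0 < r) (ht : t ≠ c.1 - c.2)
    {F : Set ℝ} (hF : F.Finite) :
    ∃ x ∈ Icc (c.1 - r) (c.1 + r), x ∉ Prod.fst '' (diagSeg t L ∩ sq c r) ∧ x ∉ F := by
  obtain ⟨a, b, hab, hsub, hmiss⟩ := exists_Ioo_fst_missed L hr ht
  obtain ⟨x, hx, hxF⟩ := ((Set.Ioo_infinite hab).sdiff hF).nonempty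
  exact ⟨x, hsub hx, fun h => hmiss x h hx, hxF⟩

/-- A point of the second side missed by the ordinates of `diagSeg ∩ square` AND by a given finite set.
[folklore] -/
theorem exists_snd_missed {t : ℝ} (L : ℝ) {c : ℝ × ℝ} {r : ℝ} (hr : 0 < r) (ht : t ≠ c.1 - c.2)
    {F : Set ℝ} (hF : F.Finite) :
    ∃ z ∈ Icc (c.2 - r) (c.2 + r), z ∉ Prod.snd '' (diagSeg t L ∩ sq c r) ∧ z ∉ F := by
  obtain ⟨a, b, hab, hsub, hmiss⟩ := exists_Ioo_snd_missed L hr ht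
  obtain ⟨z, hz, hzF⟩ := ((Set.Ioo_infinite hab).sdiff hF).nonempty
  exact ⟨z, hsub hz, fun h => hmiss z h hz, hzF⟩

/-- `Argmin(𝕊, B) = {q ∈ 𝕊 : B(q) = min_𝕊 B}` (v5 l.3084; [CY2] p. 273 `M_{d,u*}(S)`; [C17b] p. 205
`argmin(…)|_D`). [folklore] -/
def Argmin (S : Set (ℝ × ℝ)) (B : ℝ × ℝ → ℝ) : Set (ℝ × ℝ) :=
  {q | q ∈ S ∧ ∀ q' ∈ S, B q ≤ B q'}

/-- Cheng–Xue's hypothesis at l.3096 for a family of squares, in the exact format of what Lemma `LmFundamental`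
delivers ((Z1) l.3110 and (Z2) l.3131): on EVERY square of the family both projections of the local Argmin are
proper subsets of the corresponding sides. [folklore] -/
def LocalArgminsTrivial {ι : Type*} (c : ι → ℝ × ℝ) (r : ι → ℝ) (B : ℝ × ℝ → ℝ) : Prop :=
  ∀ i, Prod.fst '' Argmin (sq (c i) (r i)) B ≠ Prod.fst '' sq (c i) (r i) ∧
    Prod.snd '' Argmin (sq (c i) (r i)) B ≠ Prod.snd '' sq (c i) (r i)

/-- FUNCTION-LEVEL COUNTER-MODEL. For every finite family of closed axis-parallel squares with positive radii
(any centres, any radii) and every `D` there is a continuous function `B` on `ℝ × ℝ` (the distance to a diagonal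
segment in general position united with the set of centres) such that (Z1)–(Z2) hold on EVERY square of the
family, while the set of global minimum points of `B` contains a compact connected set of diameter `> D`.
Hence "Argmin(𝕊_j, B) is trivial for every 𝕊_j ⟹ every connected component of the minimum set has diameter
≤ (4/5)d₁" (v5 l.3096; [C17b] p. 205 "≤ 2d"; [CY2] p. 274 "totally disconnected") is not a valid inference for
continuous functions and finite (l.3096, [C17b]) families of squares; for the countable families of [CY2] p. 274
see the cell's GAPS block (the same segment with an offset outside a countable set). [folklore] -/
theorem localArgminsTrivial_not_sufficient {ι : Type*} [Finite ι] (c : ι → ℝ × ℝ) (r : ι → ℝ)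
    (hr : ∀ i, 0 < r i) (D : ℝ) :
    ∃ B : ℝ × ℝ → ℝ, Continuous B ∧ LocalArgminsTrivial c r B ∧
      ∃ K : Set (ℝ × ℝ), K ⊆ {q | ∀ q' : ℝ × ℝ, B q ≤ B q'} ∧ IsCompact K ∧ IsConnected K ∧
        D < Metric.diam K := by
  classical
  have hinf : (Set.range fun i => (c i).1 - (c i).2)ᶜ.Infinite := (Set.finite_range _).infinite_compl
  obtain ⟨t, ht⟩ := hinf.nonempty
  have ht' : ∀ i, t ≠ (c i).1 - (c i).2 := fun i h => ht ⟨i, h.symm⟩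
  set L : ℝ := |D| + 1 with hLdef
  have hL : 0 ≤ L := by positivity
  set M : Set (ℝ × ℝ) := diagSeg t L ∪ Set.range c with hMdef
  have hMclosed : IsClosed M :=
    (diagSeg_isCompact t L).isClosed.union (Set.finite_range c).isClosed
  have hMne : M.Nonempty := ⟨((0 : ℝ), -t), Or.inl (diagSeg_endpoints_mem t hL).1⟩
  have hFin1 : (Prod.fst '' Set.range c).Finite := (Set.finite_range c).image _
  have hFin2 : (Prod.snd '' Set.range c).Finite := (Set.finite_range c).image _
  refine ⟨fun q => Metric.infDist q M, Metric.continuous_infDist_pt M, ?_, ?_⟩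
  · intro i
    -- the local Argmin over the `i`-th square consists of zeros of `infDist · M`, i.e. of points of `M`
    have hAsub : Argmin (sq (c i) (r i)) (fun q => Metric.infDist q M) ⊆ M ∩ sq (c i) (r i) := by
      rintro q ⟨hqS, hmin⟩
      have hci : c i ∈ sq (c i) (r i) := centre_mem_sq (c i) (hr i).le
      have h0 : Metric.infDist (c i) M = 0 := Metric.infDist_zero_of_mem (Set.mem_union_right _ ⟨i, rfl⟩)
      have hle : Metric.infDist q M ≤ 0 := by simpa [h0] using hmin (c i) hci
      have hq0 : Metric.infDist q M = 0 := le_antisymm hle Metric.infDist_nonneg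
      exact ⟨(hMclosed.mem_iff_infDist_zero hMne).mpr hq0, hqS⟩
    refine ⟨?_, ?_⟩
    · obtain ⟨x, hxI, hxseg, hxF⟩ := exists_fst_missed L (hr i) (ht' i) hFin1
      intro hEq
      have hx : x ∈ Prod.fst '' sq (c i) (r i) :=
        ⟨(x, (c i).2), ⟨abs_le.mpr ⟨by linarith [hxI.1], by linarith [hxI.2]⟩, by simp [(hr i).le]⟩, rfl⟩
      rw [← hEq] at hx
      obtain ⟨q, hqA, hqx⟩ := hx
      obtain ⟨hqM, hqS⟩ := hAsub hqA
      rcases hqM with hqseg | hqc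
      · exact hxseg ⟨q, ⟨hqseg, hqS⟩, hqx⟩
      · exact hxF ⟨q, hqc, hqx⟩
    · obtain ⟨z, hzI, hzseg, hzF⟩ := exists_snd_missed L (hr i) (ht' i) hFin2
      intro hEq
      have hz : z ∈ Prod.snd '' sq (c i) (r i) :=
        ⟨((c i).1, z), ⟨by simp [(hr i).le], abs_le.mpr ⟨by linarith [hzI.1], by linarith [hzI.2]⟩⟩, rfl⟩
      rw [← hEq] at hz
      obtain ⟨q, hqA, hqz⟩ := hz
      obtain ⟨hqM, hqS⟩ := hAsub hqA
      rcases hqM with hqseg | hqc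
      · exact hzseg ⟨q, ⟨hqseg, hqS⟩, hqz⟩
      · exact hzF ⟨q, hqc, hqz⟩
  · refine ⟨diagSeg t L, ?_, diagSeg_isCompact t L, diagSeg_isConnected t hL, ?_⟩
    · intro q hq q'
      show Metric.infDist q M ≤ Metric.infDist q' M
      rw [Metric.infDist_zero_of_mem (Set.mem_union_left _ hq)]
      exact Metric.infDist_nonneg
    · calc D < L := by rw [hLdef]; linarith [le_abs_self D]
        _ ≤ Metric.diam (diagSeg t L) := le_diam_diagSeg t hL

end Literature.Dynamics.Hamiltonian.ChengXue2023
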